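import Summits.CriticalPhenomena.Ising3D.TaylorRegionCheckHybridL
import Summits.CriticalPhenomena.Ising3D.TaylorTable
import Literature.MathematicalPhysics.QuantumFieldTheory.ConformalBootstrap3D.HRCoeffTM
import Mathlib.Tactic.Linarith
import Mathlib.Tactic.Positivity
import Mathlib.Tactic.Ring
import HarnessLib

/-!
# The TABLE layer of a derivative certificate, XIV: FAST even head cells (interval rows in `E` × Taylor models in `Δ`; no expression trees)
(cell `pub-ising3x`, seat boot-1 gen 7; gate (g2) — cost repair of the head layer)

HONEST FRAMING: lottery ticket; floor = tightest certified 3D Ising CFT bounds; no exact-solution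
claim without a proof. Island framing: certified exclusion region at stated derivative order and
assumptions; not a determination of the 3D Ising critical exponents beyond that.

MEASURED (boot-1 g7, HOME/pub-ising3x-boot-1/COST-HEAD-KERNEL.md): the "POLYBOX" even head check of
`TaylorTableEvenHead` (`evenHead_nonneg_of_kdCheck`: natural interval extension of the expression TREES
`evenHeadXExpr` / `evenHeadDetExpr` on kd-leaves) costs ≈ 9 300 expression nodes per kernel-second (the identity
obligation of the Λ = 11 fixture: 186 941 nodes, 20 s), and the canonical head set of the first spin-0 cell has
3.5·10⁷ (E₀ = 12) … 1.8·10⁹ (E₀ = 40) nodes — hours to days of kernel time PER LEAF PER CELL. This file is the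
replacement with the SAME conclusion per cell: every q-sum `E ↦ X̂_k(E, j)` (component `k`, integer `j`) is a
polynomial of degree ≤ Λ in `E` whose coefficients are enclosed over the `(Δσ, Δε)`-box by recog-1's computable
interval rows `qRowI` (TaylorRegionCheckHybrid / TaylorQPolyIntervalList); a table carries these rows ONCE as
data (`EvenRows`, checked by coefficientwise containment `EvenRows.check`). On a cell `Δ = ctr + ρ`,
`|ρ| ≤ 2^{-e}`, the coefficients `A_{n,j}(Δ, ℓ)` are the Literature TAYLOR MODELS `HRTM.rows` (HRCoeffTM,
`HRTM.tmem_rows`: for each fixed `ρ` a polynomial in `ρ` with coefficients in the model), so a head cell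
`Σ_{(n,j)∈F} (A_{n,j}(Δ)/λ_ℓ)(½)^n X̂_k(Δ + n, j)` becomes — for each fixed `Δ` — a polynomial in the LOCAL
variable `ρ` with coefficients in `headPolyTM` (rows Taylor-shifted to `n + ctr`, multiplied by the models,
scaled by `(λ_ℓ 2^n)⁻¹`); no coefficient enclosures are carried or assumed. `X̃ > 0`, `Ỹ > 0` on the cell are two
calls of the tree's sign checker `posOn` and `4X̃Ỹ - Z̃² > 0` one call of recog-1's LOCAL-PRODUCT discriminant
checker `posOnD` (TaylorRegionCheckHybridL: shift first, multiply after). Cost per cell: the coefficient models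
(O(nF·(ℓ+nF)·D) interval operations) plus O(|F|·(Λ+D)²) for the head polynomials plus `posOn`/`posOnD` — independent
of the size of the closed-form expression; the exact-integer Python twin (seat tools/hrtm.py) runs a 185-term cell
`ℓ = 10, Δ ∈ [20, 22]` of the Λ = 11 fixture functional in 0.2 s and it PASSES (kernel timings in the fixture file).
Main results: `EvenRows.Valid` (the row contract) / `EvenRows.check` + `valid_of_check` (zeroth-order row check: the
`(Δσ, Δε)`-dependence by plain intervals — adequate for point boxes and very narrow boxes; wide boxes want Taylor-model
rows, a later file with the same `Valid` conclusion), `EvenCellTM`, `headPolyTM`/`headPolyTMR`/`pmem_headPolyTM`,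
`evenHeadTMOK`, **`evenHead_nonneg_of_tmOK`** (conclusion: that of `evenHead_nonneg_of_kdCheck` on the cell, WITHOUT
an enclosure hypothesis). SUFFICIENT only (interval slack).
Sources: Kos–Poland–Simmons-Duffin 2014 §3.3 eq. (3.16) (the obligation); Moore 1966 Ch. 3 (interval Horner /
subdivision). Elementary given the tree.
-/

namespace Summit.CriticalPhenomena.Ising3D

open Finset Set
open Literature.Analysis.ValidatedNumerics Literature.Analysis.ValidatedNumerics.PolyMP
open Literature.Analysis.ValidatedNumerics.NumericsMP (MI)
open Literature.MathematicalPhysics.QuantumFieldTheory.ConformalBootstrap3D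
open Literature.MathematicalPhysics.QuantumFieldTheory.ConformalBootstrap3D.PointKernel (legendreLamQ cast_legendreLamQ)

/-! ### Small interval helpers -/

/-- The interval `[lo, hi]` (rational endpoints) at scale `S`. [folklore] -/
def ratIvl (S : ℕ) (lo hi : ℚ) : MI := MI.span (PolyMP.ofRat S lo) (PolyMP.ofRat S hi)

/-- [folklore] -/
theorem mem_ratIvl (S : ℕ) {lo hi : ℚ} {x : ℝ} (h1 : (lo : ℝ) ≤ x) (h2 : x ≤ hi) :
    MI.mem S x (ratIvl S lo hi) :=
  MI.mem_span (mem_ofRat S lo) (mem_ofRat S hi) h1 h2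

/-- Coefficientwise containment of interval polynomials of equal length. [folklore] -/
def subsetI : IPoly → IPoly → Bool
  | [], [] => true
  | I :: P, J :: Q => decide (J.lo ≤ I.lo) && decide (I.hi ≤ J.hi) && subsetI P Q
  | _, _ => false

/-- [folklore] -/
theorem pmem_of_subsetI {S : ℕ} : ∀ {as : List ℝ} {P Q : IPoly}, PMem S as P → subsetI P Q = true → PMem S as Q
  | _, _, Q, List.Forall₂.nil, h => by
      cases Q with
      | nil => exact pmem_nil S
      | cons J Q => simp [subsetI] at h
  | _, _, Q, List.Forall₂.cons (a := a) (b := I) (l₁ := as) (l₂ := P) ha hP, h => by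
      cases Q with
      | nil => simp [subsetI] at h
      | cons J Q =>
        simp only [subsetI, Bool.and_eq_true, decide_eq_true_eq] at h
        obtain ⟨⟨h1, h2⟩, h3⟩ := h
        refine pmem_cons ?_ (pmem_of_subsetI hP h3)
        simp only [MI.mem] at ha ⊢
        exact ⟨le_trans (by exact_mod_cast h1) ha.1, ha.2.trans (by exact_mod_cast h2)⟩

/-! ### Interval rows of the functional, carried once per table -/

/-- The interval rows of a functional on a box: `RX[j] ∋ E ↦ X̂(E, j)` (component `0`, exponent `Δσ`),
`RY[j]` (component `1`, `Δε`), `RZ[j]` (components `3` + `4`, exponent `s̄ = (Δσ+Δε)/2`), for `j < J`. [folklore] -/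
structure EvenRows where
  /-- fixed-point scale -/
  S : ℕ
  /-- number of rows -/
  J : ℕ
  /-- rows of `X̂` -/
  RX : List IPoly
  /-- rows of `Ŷ` -/
  RY : List IPoly
  /-- rows of `Ẑ = Ẑ₋ + Ẑ₊` -/
  RZ : List IPoly

namespace EvenRows

variable (R : EvenRows)

/-- The computed interval rows on the box (recog-1's `qRowI`). [folklore] -/
def rowXI (c : Fin 5 → ℕ × ℕ → ℚ) (L : List (ℕ × ℕ)) (σlo σhi : ℚ) (j : ℕ) : IPoly :=
  qRowI R.S (c 0) (-1) (ratIvl R.S σlo σhi) L j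

/-- See `rowXI`. [folklore] -/
def rowYI (c : Fin 5 → ℕ × ℕ → ℚ) (L : List (ℕ × ℕ)) (εlo εhi : ℚ) (j : ℕ) : IPoly :=
  qRowI R.S (c 1) (-1) (ratIvl R.S εlo εhi) L j

/-- See `rowXI`. [folklore] -/
def rowZI (c : Fin 5 → ℕ × ℕ → ℚ) (L : List (ℕ × ℕ)) (σlo σhi εlo εhi : ℚ) (j : ℕ) : IPoly :=
  addI (qRowI R.S (c 3) (-1) (ratIvl R.S ((σlo + εlo) / 2) ((σhi + εhi) / 2)) L j)
    (qRowI R.S (c 4) 1 (ratIvl R.S ((σlo + εlo) / 2) ((σhi + εhi) / 2)) L j)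

/-- Row `j` is OK: each carried row contains the computed one. [folklore] -/
def rowsOK (c : Fin 5 → ℕ × ℕ → ℚ) (L : List (ℕ × ℕ)) (σlo σhi εlo εhi : ℚ) (j : ℕ) : Bool :=
  subsetI (R.rowXI c L σlo σhi j) (R.RX.getD j []) && subsetI (R.rowYI c L εlo εhi j) (R.RY.getD j []) &&
    subsetI (R.rowZI c L σlo σhi εlo εhi j) (R.RZ.getD j [])

/-- Rows `a ≤ j < b` are OK (so that an instance can split the row check over several `decide`s / files). [folklore] -/
def checkRange (c : Fin 5 → ℕ × ℕ → ℚ) (L : List (ℕ × ℕ)) (σlo σhi εlo εhi : ℚ) (a b : ℕ) : Bool :=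
  (List.range (b - a)).all fun i => R.rowsOK c L σlo σhi εlo εhi (a + i)

/-- **Row check** (one shot): positive scale and all rows `j < J` OK. [folklore] -/
def check (c : Fin 5 → ℕ × ℕ → ℚ) (L : List (ℕ × ℕ)) (σlo σhi εlo εhi : ℚ) : Bool :=
  decide (0 < R.S) && R.checkRange c L σlo σhi εlo εhi 0 R.J

/-- Pointwise reading of `checkRange`. [folklore] -/
theorem rowsOK_of_checkRange {c : Fin 5 → ℕ × ℕ → ℚ} {L : List (ℕ × ℕ)} {σlo σhi εlo εhi : ℚ} {a b : ℕ}
    (h : R.checkRange c L σlo σhi εlo εhi a b = true) {j : ℕ} (haj : a ≤ j) (hjb : j < b) :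
    R.rowsOK c L σlo σhi εlo εhi j = true := by
  simp only [checkRange, List.all_eq_true, List.mem_range] at h
  have := h (j - a) (by omega)
  rwa [show a + (j - a) = j by omega] at this

/-- Gluing two ranges. [folklore] -/
theorem checkRange_append {c : Fin 5 → ℕ × ℕ → ℚ} {L : List (ℕ × ℕ)} {σlo σhi εlo εhi : ℚ} {a b d : ℕ}
    (h1 : R.checkRange c L σlo σhi εlo εhi a b = true)
    (h2 : R.checkRange c L σlo σhi εlo εhi b d = true) : R.checkRange c L σlo σhi εlo εhi a d = true := by
  simp only [checkRange, List.all_eq_true, List.mem_range]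
  intro i hi
  by_cases hlt : a + i < b
  · exact R.rowsOK_of_checkRange h1 (by omega) hlt
  · exact R.rowsOK_of_checkRange h2 (by omega) (by omega)

/-- The real rows: `X̂(·, j)`, `Ŷ(·, j)`, `Ẑ(·, j)` as coefficient lists. [folklore] -/
noncomputable def rowX (c : Fin 5 → ℕ × ℕ → ℚ) (L : List (ℕ × ℕ)) (Δσ : ℝ) (j : ℕ) : List ℝ := qRow (c 0) (-1) Δσ L j
/-- [folklore] -/
noncomputable def rowY (c : Fin 5 → ℕ × ℕ → ℚ) (L : List (ℕ × ℕ)) (Δε : ℝ) (j : ℕ) : List ℝ := qRow (c 1) (-1) Δε L j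
/-- [folklore] -/
noncomputable def rowZ (c : Fin 5 → ℕ × ℕ → ℚ) (L : List (ℕ × ℕ)) (sb : ℝ) (j : ℕ) : List ℝ :=
  addR (qRow (c 3) (-1) sb L j) (qRow (c 4) 1 sb L j)

/-- **Row validity** (the abstract contract a row check establishes): positive scale and, for every `(Δσ, Δε)` of
the box and every `j < J`, the real rows lie coefficientwise in the carried interval rows. Any checker concluding this
(the zeroth-order `check` below; Taylor-model row checks for wide boxes in later files) feeds the cell theorem. [folklore] -/
def Valid (c : Fin 5 → ℕ × ℕ → ℚ) (L : List (ℕ × ℕ)) (σlo σhi εlo εhi : ℚ) : Prop :=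
  0 < R.S ∧ ∀ Δσ ∈ Icc (σlo : ℝ) σhi, ∀ Δε ∈ Icc (εlo : ℝ) εhi, ∀ j < R.J,
    PMem R.S (rowX c L Δσ j) (R.RX.getD j []) ∧ PMem R.S (rowY c L Δε j) (R.RY.getD j []) ∧
      PMem R.S (rowZ c L ((Δσ + Δε) / 2) j) (R.RZ.getD j [])

/-- **Soundness of the zeroth-order row check, ranged form**: positive scale and all rows `j < J` OK ⇒ `Valid`.
[folklore] -/
theorem valid_of_checkRange {c : Fin 5 → ℕ × ℕ → ℚ} {L : List (ℕ × ℕ)} {σlo σhi εlo εhi : ℚ} (hS : 0 < R.S)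
    (h : R.checkRange c L σlo σhi εlo εhi 0 R.J = true) : R.Valid c L σlo σhi εlo εhi := by
  refine ⟨hS, fun Δσ hσ Δε hε j hj => ?_⟩
  have hrow := R.rowsOK_of_checkRange h (Nat.zero_le j) hj
  simp only [rowsOK, Bool.and_eq_true] at hrow
  obtain ⟨⟨hx, hy⟩, hz⟩ := hrow
  have hsσ := mem_ratIvl R.S hσ.1 hσ.2
  have hsε := mem_ratIvl R.S hε.1 hε.2
  have hsb : MI.mem R.S ((Δσ + Δε) / 2) (ratIvl R.S ((σlo + εlo) / 2) ((σhi + εhi) / 2)) := by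
    refine mem_ratIvl R.S ?_ ?_
    · push_cast; linarith [hσ.1, hε.1]
    · push_cast; linarith [hσ.2, hε.2]
  exact ⟨pmem_of_subsetI (pmem_qRowI hS _ _ hsσ L j) hx, pmem_of_subsetI (pmem_qRowI hS _ _ hsε L j) hy,
    pmem_of_subsetI (pmem_addI (pmem_qRowI hS _ _ hsb L j) (pmem_qRowI hS _ _ hsb L j)) hz⟩

/-- **Soundness of the zeroth-order row check**: `check = true → Valid`. [folklore] -/
theorem valid_of_check {c : Fin 5 → ℕ × ℕ → ℚ} {L : List (ℕ × ℕ)} {σlo σhi εlo εhi : ℚ}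
    (h : R.check c L σlo σhi εlo εhi = true) : R.Valid c L σlo σhi εlo εhi := by
  simp only [check, Bool.and_eq_true, decide_eq_true_eq] at h
  exact R.valid_of_checkRange h.1 h.2

end EvenRows

/-! ### Head cells with Taylor-model coefficients -/

/-- An even head cell for the FAST layer: spin `ℓ`, the `Δ`-cell `[ctr - 2^{-e}, ctr + 2^{-e}]`, the degree `D` of the
Taylor models of the `A_{n,j}(Δ, ℓ)` (computed by the kernel with `HRTM.rows`, Literature `HRCoeffTM`), and the head
list `F`. No coefficient data is carried. [folklore] -/
structure EvenCellTM where
  /-- even spin -/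
  ℓ : ℕ
  /-- centre of the `Δ`-cell -/
  ctr : ℚ
  /-- the cell has half-width `2^{-e}` -/
  e : ℕ
  /-- degree of the coefficient Taylor models -/
  D : ℕ
  /-- head list -/
  F : List (ℕ × ℕ)

namespace EvenCellTM

variable (C : EvenCellTM)

/-- Half-width. [folklore] -/
def hw : ℚ := 1 / 2 ^ C.e
/-- Left end. [folklore] -/
def lo : ℚ := C.ctr - C.hw
/-- Right end. [folklore] -/
def hi : ℚ := C.ctr + C.hw
/-- Highest level `n` in the head list. [folklore] -/
def nF : ℕ := C.F.foldr (fun q m => max q.1 m) 0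

/-- [folklore] -/
theorem le_nF : ∀ q ∈ C.F, q.1 ≤ C.nF := by
  unfold nF
  induction C.F with
  | nil => simp
  | cons q qs ih =>
      intro q' hq'
      simp only [List.foldr_cons]
      rcases List.mem_cons.mp hq' with rfl | h
      · exact le_max_left _ _
      · exact (ih q' h).trans (le_max_right _ _)

end EvenCellTM

/-- The interval head polynomial in the LOCAL variable `ρ = Δ - ctr`:
`Σ_{(n,j)∈F} (λ_ℓ 2^n)⁻¹ · TM_{n,j}(ρ) · row_j(n + ctr + ρ)`. [folklore] -/
def headPolyTM (S : ℕ) (rows : List IPoly) (tms : List (List IPoly)) (nF ℓ : ℕ) (ctr : ℚ) :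
    List (ℕ × ℕ) → IPoly
  | [] => []
  | q :: qs => addI (smulQI (1 / (legendreLamQ ℓ * 2 ^ q.1))
      (mulI S (HRTM.rowEntry tms nF q.1 q.2) (shiftI S (rows.getD q.2 []) (PolyMP.ofRat S ((q.1 : ℚ) + ctr)))))
      (headPolyTM S rows tms nF ℓ ctr qs)

/-- Its real shadow for given coefficient lists `asq q` (the Taylor polynomials realised at one `ρ`). [folklore] -/
noncomputable def headPolyTMR (row : ℕ → List ℝ) (asq : ℕ × ℕ → List ℝ) (ℓ : ℕ) (ctr : ℚ) :
    List (ℕ × ℕ) → List ℝ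
  | [] => []
  | q :: qs => addR (smulR ((1 / (legendreLamQ ℓ * 2 ^ q.1) : ℚ) : ℝ)
      (mulR (asq q) (shiftR (row q.2) (((q.1 : ℚ) + ctr : ℚ) : ℝ)))) (headPolyTMR row asq ℓ ctr qs)

/-- [folklore] -/
theorem evalR_headPolyTMR (row : ℕ → List ℝ) (asq : ℕ × ℕ → List ℝ) (ℓ : ℕ) (ctr : ℚ) (ρ : ℝ) :
    ∀ F : List (ℕ × ℕ), evalR (headPolyTMR row asq ℓ ctr F) ρ =
      (F.map fun q => (((1 / (legendreLamQ ℓ * 2 ^ q.1) : ℚ) : ℝ) * evalR (asq q) ρ *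
        evalR (row q.2) ((q.1 : ℝ) + (ctr : ℝ) + ρ))).sum
  | [] => by simp [headPolyTMR]
  | q :: qs => by
      rw [headPolyTMR, evalR_addR, evalR_smulR, evalR_mulR, evalR_shiftR, evalR_headPolyTMR row asq ℓ ctr ρ qs,
        List.map_cons, List.sum_cons]
      push_cast
      ring

/-- **Coefficientwise membership of the real head polynomial in the interval one.** [folklore] -/
theorem pmem_headPolyTM {S : ℕ} (hS : 0 < S) {row : ℕ → List ℝ} {rows : List IPoly} {asq : ℕ × ℕ → List ℝ}
    {tms : List (List IPoly)} {nF ℓ : ℕ} {ctr : ℚ} :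
    ∀ F : List (ℕ × ℕ), (∀ q ∈ F, PMem S (row q.2) (rows.getD q.2 [])) →
      (∀ q ∈ F, PMem S (asq q) (HRTM.rowEntry tms nF q.1 q.2)) →
      PMem S (headPolyTMR row asq ℓ ctr F) (headPolyTM S rows tms nF ℓ ctr F)
  | [], _, _ => by simpa [headPolyTMR, headPolyTM] using pmem_nil S
  | q :: qs, hrow, hasq => by
      rw [headPolyTMR, headPolyTM]
      refine pmem_addI (pmem_smulQI _ rfl (pmem_mulI hS (hasq q (by simp))
        (pmem_shiftI hS (mem_ofRat S _) (hrow q (by simp))))) ?_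
      exact pmem_headPolyTM hS qs (fun q' h => hrow q' (List.mem_cons_of_mem _ h))
        (fun q' h => hasq q' (List.mem_cons_of_mem _ h))

/-! ### The fast cell check and its soundness -/

/-- **FAST even head cell check** (Taylor-model coefficients): positive scale, `1 ≤ D`, the pivot condition of the
coefficient recursion on the cell, head indices within the row table and the level range, then `posOn` on the local
cell `[-2^{-e}, 2^{-e}]` for `X̃` and `Ỹ` and the local-product discriminant test `posOnD` for `4X̃Ỹ - Z̃²`
(bisection depth `dP`). [folklore] -/
def evenHeadTMOK (R : EvenRows) (dP : ℕ) (C : EvenCellTM) : Bool :=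
  let tms := HRTM.rows R.S C.ctr C.ℓ C.e C.D C.nF
  let HX := headPolyTM R.S R.RX tms C.nF C.ℓ C.ctr C.F
  let HY := headPolyTM R.S R.RY tms C.nF C.ℓ C.ctr C.F
  let HZ := headPolyTM R.S R.RZ tms C.nF C.ℓ C.ctr C.F
  decide (0 < R.S) && decide (1 ≤ C.D) && HRTM.pivOK C.ctr C.ℓ C.e C.nF &&
    (C.F.all fun q => decide (q.2 < R.J)) &&
    posOn R.S dP HX (-C.hw) C.hw && posOn R.S dP HY (-C.hw) C.hw && posOnD R.S HX HY HZ dP (-C.hw) C.hw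

/-- The head entry `evenHeadX` at `Δ = ctr + ρ` is the value at `ρ` of the real head polynomial built on the
q-rows and on coefficient lists realising the `A_{n,j}(ctr + ρ)`. [folklore] -/
theorem evenHeadX_eq_evalR_TM (c : Fin 5 → ℕ × ℕ → ℚ) {L : List (ℕ × ℕ)} (hL : L.Nodup) (k : Fin 5) (σQ : ℚ)
    (ℓ : ℕ) (ctr : ℚ) (F : List (ℕ × ℕ)) (s ρ : ℝ) {asq : ℕ × ℕ → List ℝ}
    (hasq : ∀ q ∈ F, hrCoeff ((ctr : ℝ) + ρ) ℓ q.1 q.2 = evalR (asq q) ρ) :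
    evenHeadX (fun ab => (c k ab : ℝ)) L.toFinset ℓ F s ((ctr : ℝ) + ρ) (σQ : ℝ) =
      evalR (headPolyTMR (fun j => qRow (c k) σQ s L j) asq ℓ ctr F) ρ := by
  rw [evalR_headPolyTMR, evenHeadX]
  congr 1
  refine List.map_congr_left fun q hq => ?_
  rw [← qSum_eq_evalR_qRow (c k) σQ s hL q.2, ← hasq q hq,
    show (q.1 : ℝ) + (ctr : ℝ) + ρ = (ctr : ℝ) + ρ + (q.1 : ℝ) by ring]
  have hlam : ((legendreLamQ ℓ : ℚ) : ℝ) = legendreLam ℓ := cast_legendreLamQ ℓ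
  push_cast
  rw [hlam]
  have hl0 : legendreLam ℓ ≠ 0 := (legendreLam_pos ℓ).ne'
  have h2 : (2 : ℝ) ^ q.1 ≠ 0 := pow_ne_zero _ two_ne_zero
  rw [one_div_pow]
  field_simp

/-- `Z̃ = Z̃₋ + Z̃₊` on the summed rows, Taylor-model form. [folklore] -/
theorem evenHeadZ_eq_evalR_TM (c : Fin 5 → ℕ × ℕ → ℚ) {L : List (ℕ × ℕ)} (hL : L.Nodup)
    (ℓ : ℕ) (ctr : ℚ) (F : List (ℕ × ℕ)) (s ρ : ℝ) {asq : ℕ × ℕ → List ℝ}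
    (hasq : ∀ q ∈ F, hrCoeff ((ctr : ℝ) + ρ) ℓ q.1 q.2 = evalR (asq q) ρ) :
    evenHeadX (fun ab => (c 3 ab : ℝ)) L.toFinset ℓ F s ((ctr : ℝ) + ρ) (-1) +
        evenHeadX (fun ab => (c 4 ab : ℝ)) L.toFinset ℓ F s ((ctr : ℝ) + ρ) 1 =
      evalR (headPolyTMR (fun j => EvenRows.rowZ c L s j) asq ℓ ctr F) ρ := by
  have h3 := evenHeadX_eq_evalR_TM c hL 3 (-1) ℓ ctr F s ρ hasq
  have h4 := evenHeadX_eq_evalR_TM c hL 4 1 ℓ ctr F s ρ hasq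
  push_cast at h3 h4
  rw [h3, h4, evalR_headPolyTMR, evalR_headPolyTMR, evalR_headPolyTMR, ← List.sum_map_add]
  congr 1
  refine List.map_congr_left fun q _ => ?_
  rw [EvenRows.rowZ, evalR_addR]
  ring

/-- **TABLE THEOREM, even head cell, FAST form (Taylor-model coefficients, no enclosure data).** For rational
weights `c` on the duplicate-free index list `L`, a cell `C` (spin `ℓ`, centre `ctr`, half-width `2^{-e}`, `ℓ ≤ lo`,
head list `F` duplicate-free and in the descendant range `j ≤ ℓ + n`), a VALID row table `R` on the box and
`evenHeadTMOK R dP C = true`: the head form is PSD at every `(Δσ, Δε)` of the box and every `Δ` of the cell —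
the conclusion of `evenHead_nonneg_of_kdCheck` for the cell `[C.lo, C.hi]`, with the coefficient enclosures now
PROVED (Literature `HRTM.tmem_rows`) instead of assumed. [cite: KosPolandSimmonsduffin2014, §3.3 eq. (3.16)] -/
theorem evenHead_nonneg_of_tmOK (c : Fin 5 → ℕ × ℕ → ℚ) {L : List (ℕ × ℕ)} (hL : L.Nodup)
    {C : EvenCellTM} (hF : C.F.Nodup) (hFj : ∀ q ∈ C.F, q.2 ≤ C.ℓ + q.1) (hℓlo : (C.ℓ : ℚ) ≤ C.lo)
    {σlo σhi εlo εhi : ℚ} {R : EvenRows} (hR : R.Valid c L σlo σhi εlo εhi)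
    {dP : ℕ} (h : evenHeadTMOK R dP C = true) :
    ∀ p ∈ Icc (σlo : ℝ) σhi ×ˢ Icc (εlo : ℝ) εhi, ∀ Δ : ℝ, (C.lo : ℝ) ≤ Δ → Δ ≤ C.hi → ∀ a b : ℝ,
      0 ≤ ∑ q ∈ C.F.toFinset, hrCoeff Δ C.ℓ q.1 q.2 / legendreLam C.ℓ *
        (taylorCrossing (1 / 2) (1 / 2) L.toFinset (fun i ab => (c i ab : ℝ))).evenForm p.1 p.2
          (zMono (Δ + (q.1 : ℝ)) q.2) a b := by
  intro p hp Δ hlo hhi a b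
  obtain ⟨hσ, hε⟩ := hp
  simp only [evenHeadTMOK, Bool.and_eq_true, decide_eq_true_eq, List.all_eq_true] at h
  obtain ⟨⟨⟨⟨⟨⟨hS, hD⟩, hpiv⟩, hJ⟩, hX⟩, hY⟩, hDisc⟩ := h
  -- the local variable
  set ρ : ℝ := Δ - (C.ctr : ℝ) with hρdef
  have hΔ : Δ = (C.ctr : ℝ) + ρ := by rw [hρdef]; ring
  have hlo' : ((C.lo : ℚ) : ℝ) = (C.ctr : ℝ) - ((C.hw : ℚ) : ℝ) := by rw [EvenCellTM.lo]; push_cast; ring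
  have hhi' : ((C.hi : ℚ) : ℝ) = (C.ctr : ℝ) + ((C.hw : ℚ) : ℝ) := by rw [EvenCellTM.hi]; push_cast; ring
  have hρ1 : ((-C.hw : ℚ) : ℝ) ≤ ρ := by push_cast; linarith
  have hρ2 : ρ ≤ ((C.hw : ℚ) : ℝ) := by linarith
  have hρabs : |ρ| ≤ ((1 : ℚ) / 2 ^ C.e : ℚ) := by
    have : ((C.hw : ℚ) : ℝ) = (((1 : ℚ) / 2 ^ C.e : ℚ) : ℝ) := by rw [EvenCellTM.hw]
    rw [abs_le, ← this]; exact ⟨by linarith, hρ2⟩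
  have hhw : -C.hw ≤ C.hw := by
    have : (0 : ℚ) ≤ C.hw := by rw [EvenCellTM.hw]; positivity
    linarith
  have hℓΔ : (C.ℓ : ℝ) ≤ Δ := by
    have : ((C.ℓ : ℚ) : ℝ) ≤ ((C.lo : ℚ) : ℝ) := by exact_mod_cast hℓlo
    push_cast at this
    linarith
  -- Taylor models of the coefficients at this ρ
  have htm : ∀ q ∈ C.F, ∃ as : List ℝ, PMem R.S as (HRTM.rowEntry (HRTM.rows R.S C.ctr C.ℓ C.e C.D C.nF) C.nF q.1 q.2) ∧
      hrCoeff ((C.ctr : ℝ) + ρ) C.ℓ q.1 q.2 = evalR as ρ :=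
    fun q hq => HRTM.tmem_rows hD hpiv (C.le_nF q hq) q.2 ρ hρabs
  classical
  let asq : ℕ × ℕ → List ℝ := fun q => if hq : q ∈ C.F then Classical.choose (htm q hq) else []
  have hasq_mem : ∀ q ∈ C.F, PMem R.S (asq q) (HRTM.rowEntry (HRTM.rows R.S C.ctr C.ℓ C.e C.D C.nF) C.nF q.1 q.2) := by
    intro q hq; simp only [asq, dif_pos hq]; exact (Classical.choose_spec (htm q hq)).1
  have hasq_val : ∀ q ∈ C.F, hrCoeff ((C.ctr : ℝ) + ρ) C.ℓ q.1 q.2 = evalR (asq q) ρ := by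
    intro q hq; simp only [asq, dif_pos hq]; exact (Classical.choose_spec (htm q hq)).2
  -- rows
  have hrowX : ∀ q ∈ C.F, PMem R.S (qRow (c 0) (-1) p.1 L q.2) (R.RX.getD q.2 []) :=
    fun q hq => (hR.2 p.1 hσ p.2 hε q.2 (hJ q hq)).1
  have hrowY : ∀ q ∈ C.F, PMem R.S (qRow (c 1) (-1) p.2 L q.2) (R.RY.getD q.2 []) :=
    fun q hq => (hR.2 p.1 hσ p.2 hε q.2 (hJ q hq)).2.1
  have hrowZ : ∀ q ∈ C.F, PMem R.S (EvenRows.rowZ c L ((p.1 + p.2) / 2) q.2) (R.RZ.getD q.2 []) :=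
    fun q hq => (hR.2 p.1 hσ p.2 hε q.2 (hJ q hq)).2.2
  have hPX := pmem_headPolyTM hS (ℓ := C.ℓ) (ctr := C.ctr) C.F hrowX hasq_mem
  have hPY := pmem_headPolyTM hS (ℓ := C.ℓ) (ctr := C.ctr) C.F hrowY hasq_mem
  have hPZ := pmem_headPolyTM hS (ℓ := C.ℓ) (ctr := C.ctr) C.F hrowZ hasq_mem
  -- the three real values
  have eX := evenHeadX_eq_evalR_TM c hL 0 (-1) C.ℓ C.ctr C.F p.1 ρ hasq_val
  have eY := evenHeadX_eq_evalR_TM c hL 1 (-1) C.ℓ C.ctr C.F p.2 ρ hasq_val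
  have eZ := evenHeadZ_eq_evalR_TM c hL C.ℓ C.ctr C.F ((p.1 + p.2) / 2) ρ hasq_val
  push_cast at eX eY
  have h1 := posOn_sound hS hX hhw hPX hρ1 hρ2
  have h2 := posOn_sound hS hY hhw hPY hρ1 hρ2
  have h3 := posOnD_sound hS hPX hPY hPZ hDisc hhw hρ1 hρ2
  rw [← eX] at h1 h3
  rw [← eY] at h2 h3
  rw [← eZ] at h3
  rw [hΔ]
  refine evenHead_nonneg_of_reduced L.toFinset (fun i ab => (c i ab : ℝ)) C.ℓ C.F hF hFj (hΔ ▸ hℓΔ) p.1 p.2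
    h1.le h2.le ?_ a b
  nlinarith [h3]

end Summit.CriticalPhenomena.Ising3D
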